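/-
Copyright (c) 2026. All rights reserved.
Released under Apache 2.0 license as described in the file LICENSE.
Authors: abc-iut cell, seat abc-iut-w6-d109 (gen 2).
-/
import Literature.GroupTheory.TwistedCommutatorWidthProfinite
import Literature.GroupTheory.StronglyCompleteWildReductionNormalGen

/-!
# Strong completeness of profinite groups that are pro-`p` by strongly complete, with finitely
# normally generated wild layers

Let `G` be a topologically finitely generated profinite group and `P ⊴ G` a closed normal pro-`p`
subgroup such that

* (a) every finite-index subgroup of `G` containing `P` is open ("`G ⧸ P` is strongly complete"), and
* (fng) every `G`-normal subgroup `P′ ≤ P` open in `P` is topologically generated by the `G`-conjugates of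
  a FINITE set.

Then EVERY finite-index subgroup of `G` is open (`isOpen_of_finiteIndex_of_proP_of_normalGenerators`).

This completes the reduction of `Literature/GroupTheory/StronglyCompleteWildReduction.lean`
(`isOpen_of_finiteIndex_of_proP_normal`, hypotheses (a) + (c″)): its hypothesis (c″) — openness in `P′`
of the ABSTRACT subgroups `⁅P′, U⁆ · ⟨P′ ^ n⟩` for `P′ ≤ P` open `G`-normal, `U ⊇ P` open normal,
`n ≥ 1` — is DISCHARGED here (`forall_exists_isOpen_inf_le_commutator_sup_powClosure`) from (fng) alone:
the closure of `⁅P′, U⁆ · ⟨P′ ^ n⟩` is open in `P′` by finiteness of coinvariants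
(`exists_isOpen_inf_le_commutator_pow_closure_of_normalGenerators`), and `⁅P′, U⁆ · ⟨P′ ^ n⟩` is
CLOSED by the twisted Serre width theorem (`isClosed_commutator_sup_powClosure_of_proP`, after
replacing `n = p^e · n'` by `p^e` through the bijectivity of the `n'`-power map of the pro-`p` group
`P′`).  No Nikolov–Segal-type input is used.

Intended instance (cell abc-iut, GAP-LEDGER G-L3d2g2-1 / FACT F-1977 at `G_k`): `G = Gal(k̄/k)` for a
`p`-adic field `k`, `P` = wild inertia; there (a) is the strong completeness of the tame quotient
`Ẑ'(1) ⋊ Ẑ` (`StronglyCompleteAbelianByAbelian.lean`) and (fng) is the finite normal generation of the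
wild inertia of every finite extension of `k` — two structure facts about local fields, not proved
here.  HONEST FRAMING: classical profinite group theory; nothing here bears on [IUTchIII] Cor. 3.12.

[cite: DDMSAnalyticProP1999, Thm 1.17, Prop 1.19] [cite: RibesZalesskii2010, §4.2]
-/

namespace Literature.GroupTheory

open scoped Pointwise commutatorElement

variable {G : Type*} [Group G] [TopologicalSpace G] [IsTopologicalGroup G] [CompactSpace G]
  [TotallyDisconnectedSpace G]

omit [CompactSpace G] [TotallyDisconnectedSpace G] in
/-- A subgroup `P′ ≤ P` of a closed subgroup `P` containing `V ⊓ P` for an open `V` is closed.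
[cite: RibesZalesskii2010, §2.1] -/
theorem isClosed_of_isOpen_inf_le {P P' V : Subgroup G} (hPc : IsClosed (P : Set G)) (hP'P : P' ≤ P)
    (hVo : IsOpen (V : Set G)) (hV : V ⊓ P ≤ P') : IsClosed (P' : Set G) := by
  rw [← isOpen_compl_iff, isOpen_iff_forall_mem_open]
  intro x hx
  by_cases hxP : x ∈ P
  · refine ⟨{y | x⁻¹ * y ∈ (V : Set G)}, fun y hy hyP' => ?_,
      hVo.preimage (by fun_prop), by simp [V.one_mem]⟩
    have hy' : x⁻¹ * y ∈ P' := by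
      by_cases hyP : y ∈ P
      · exact hV ⟨hy, P.mul_mem (P.inv_mem hxP) hyP⟩
      · exact absurd (hP'P hyP') hyP
    exact hx (by simpa using P'.mul_mem hyP' (P'.inv_mem hy'))
  · exact ⟨(P : Set G)ᶜ, fun y hy hyP' => hy (hP'P hyP'), hPc.isOpen_compl, hxP⟩

/-- Elements of a closed pro-`p` subgroup `P` are pro-`p`-convergent in `G`: `x ^ p ^ k → 1`.
[cite: DDMSAnalyticProP1999, §1.2] -/
theorem forall_nhds_pow_mem_of_proP_subgroup {p : ℕ} (P : Subgroup G) (hPc : IsClosed (P : Set G))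
    (hP : ∀ V : OpenNormalSubgroup P, IsPGroup p (P ⧸ (V : Subgroup P))) {x : G} (hx : x ∈ P)
    {O : Set G} (hO : O ∈ nhds (1 : G)) : ∃ k : ℕ, x ^ p ^ k ∈ O := by
  haveI : CompactSpace P := isCompact_iff_compactSpace.mp hPc.isCompact
  have hO' : Subtype.val ⁻¹' O ∈ nhds (1 : P) :=
    continuous_subtype_val.continuousAt.preimage_mem_nhds (by simpa using hO)
  obtain ⟨k, hk⟩ := forall_nhds_pow_mem_of_isPGroup_quotient hP ⟨x, hx⟩ hO'
  exact ⟨k, by simpa using hk⟩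

omit [IsTopologicalGroup G] [CompactSpace G] [TotallyDisconnectedSpace G] in
/-- A closed subgroup all of whose elements are pro-`p`-convergent is pro-`p` (quotients by open normal
subgroups are `p`-groups). [cite: DDMSAnalyticProP1999, §1.2] -/
theorem isPGroup_quotient_of_forall_nhds_pow_mem {p : ℕ} (P' : Subgroup G)
    (h : ∀ x ∈ P', ∀ O ∈ nhds (1 : G), ∃ k : ℕ, x ^ p ^ k ∈ O) (W : OpenNormalSubgroup P') :
    IsPGroup p (P' ⧸ (W : Subgroup P')) := by
  refine isPGroup_quotient_openNormalSubgroup_of_forall_nhds (fun g O hO => ?_) W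
  rw [nhds_subtype_eq_comap] at hO
  obtain ⟨O', hO', hOO'⟩ := hO
  obtain ⟨k, hk⟩ := h (g : G) g.2 O' (by simpa using hO')
  refine ⟨k, hOO' ?_⟩
  show ((g ^ p ^ k : P') : G) ∈ O'
  rwa [Subgroup.coe_pow]

omit [TotallyDisconnectedSpace G] in
/-- Open subgroups of a topologically finitely generated compact group are topologically generated by
the entries of a finite LIST of their elements (Schreier, list form of
`exists_finset_dense_closure_of_isOpen`). [cite: DDMSAnalyticProP1999, Thm 1.17 (proof)] -/
theorem exists_list_closure_dense_of_isOpen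
    (hfg : ∃ S : Finset G, Dense ((Subgroup.closure (S : Set G) : Subgroup G) : Set G))
    (U : Subgroup G) (hUo : IsOpen (U : Set G)) :
    ∃ l : List G, (∀ a ∈ l, a ∈ U) ∧
      (U : Set G) ⊆ closure ((Subgroup.closure {a : G | a ∈ l} : Subgroup G) : Set G) := by
  classical
  obtain ⟨S', hS'⟩ := exists_finset_dense_closure_of_isOpen hfg U hUo
  refine ⟨S'.toList.map Subtype.val, fun a ha => ?_, ?_⟩
  · obtain ⟨s, -, rfl⟩ := List.mem_map.mp ha
    exact s.2
  · have h := Subtype.dense_iff.mp hS'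
    have hset : Subtype.val '' ((Subgroup.closure (S' : Set U) : Subgroup U) : Set U) =
        ((Subgroup.closure {a : G | a ∈ S'.toList.map Subtype.val} : Subgroup G) : Set G) := by
      rw [← Subgroup.coe_subtype, ← Subgroup.coe_map, MonoidHom.map_closure]
      congr 2
      ext a
      simp only [Subgroup.coe_subtype, Set.mem_image, Finset.mem_coe, Set.mem_setOf_eq,
        List.mem_map, Finset.mem_toList]
    exact h.trans (closure_mono hset.subset)

omit [TotallyDisconnectedSpace G] in
/-- Conjugates over `G` of a finite set `E` are conjugates over an open NORMAL subgroup `U` of the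
finite set of conjugates of `E` by coset representatives. [cite: RibesZalesskii2010, §2.1] -/
theorem exists_list_conj_subset_of_isOpen_normal (U : Subgroup G) [hUn : U.Normal]
    (hUo : IsOpen (U : Set G)) (E : Finset G) {P' : Subgroup G} [hP'n : P'.Normal]
    (hEP' : (E : Set G) ⊆ P') :
    ∃ m : List G, (∀ a ∈ m, a ∈ P') ∧
      {x : G | ∃ g : G, ∃ e ∈ E, x = g * e * g⁻¹} ⊆
        {z : G | ∃ u ∈ U, ∃ a ∈ m, z = u * a * u⁻¹} := by
  classical
  haveI : Finite (G ⧸ U) := Subgroup.quotient_finite_of_isOpen U hUo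
  haveI : Fintype (G ⧸ U) := Fintype.ofFinite _
  let R : Finset G := Finset.univ.image (Quotient.out : G ⧸ U → G)
  refine ⟨((R ×ˢ E).image fun re => re.1 * re.2 * re.1⁻¹).toList, fun a ha => ?_, ?_⟩
  · rw [Finset.mem_toList, Finset.mem_image] at ha
    obtain ⟨⟨r, e⟩, hre, rfl⟩ := ha
    exact hP'n.conj_mem e (hEP' (Finset.mem_product.mp hre).2) r
  · rintro _ ⟨g, e, he, rfl⟩
    obtain ⟨h, hh⟩ := QuotientGroup.mk_out_eq_mul U g
    set r : G := (QuotientGroup.mk g : G ⧸ U).out with hr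
    have hrR : r ∈ R := Finset.mem_image.mpr ⟨QuotientGroup.mk g, Finset.mem_univ _, rfl⟩
    -- `g = r h⁻¹ = (r h⁻¹ r⁻¹) r`
    refine ⟨r * (h : G)⁻¹ * r⁻¹, hUn.conj_mem _ (U.inv_mem h.2) r, r * e * r⁻¹, ?_, ?_⟩
    · rw [Finset.mem_toList, Finset.mem_image]
      exact ⟨(r, e), Finset.mem_product.mpr ⟨hrR, he⟩, rfl⟩
    · have hg : g = r * (h : G)⁻¹ := by rw [hh, mul_inv_cancel_right]
      rw [hg]; group

/-- **Hypothesis (c″) of `isOpen_of_finiteIndex_of_proP_normal`, DISCHARGED.** Let `G` be profinite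
and topologically finitely generated, `P ⊴ G` closed pro-`p`, and assume (fng): every `G`-normal
`P′ ≤ P` open in `P` is topologically generated by the `G`-conjugates of a finite set.  Then for all
such `P′`, every open normal `U ⊇ P` and every `n ≥ 1`, the ABSTRACT subgroup
`⁅P′, U⁆ ⊔ ⟨{x ^ n | x ∈ P′}⟩` is open in `P′`. (Closure open: finiteness of coinvariants; closed:
twisted Serre width.) [cite: DDMSAnalyticProP1999, Thm 1.17] -/
theorem forall_exists_isOpen_inf_le_commutator_sup_powClosure {p : ℕ} [hp : Fact p.Prime]
    (hfg : ∃ S : Finset G, Dense ((Subgroup.closure (S : Set G) : Subgroup G) : Set G))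
    (P : Subgroup G) (hPc : IsClosed (P : Set G))
    (hP : ∀ V : OpenNormalSubgroup P, IsPGroup p (P ⧸ (V : Subgroup P)))
    (hfng : ∀ P' : Subgroup G, P'.Normal → P' ≤ P →
      (∃ V : Subgroup G, IsOpen (V : Set G) ∧ V ⊓ P ≤ P') →
      ∃ E : Finset G, (E : Set G) ⊆ P' ∧
        P' ≤ (Subgroup.closure {x : G | ∃ g : G, ∃ e ∈ E, x = g * e * g⁻¹}).topologicalClosure) :
    ∀ P' U : Subgroup G, P'.Normal → U.Normal → P' ≤ P →
      (∃ V : Subgroup G, IsOpen (V : Set G) ∧ V ⊓ P ≤ P') → IsOpen (U : Set G) → P ≤ U →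
      ∀ n : ℕ, n ≠ 0 → ∃ V : Subgroup G, IsOpen (V : Set G) ∧
        V ⊓ P' ≤ ⁅P', U⁆ ⊔ Subgroup.closure {y | ∃ x ∈ P', x ^ n = y} := by
  intro P' U hP'n hUn hP'P hV hUo hPU n hn
  obtain ⟨V₀, hV₀o, hV₀⟩ := hV
  have hP'c : IsClosed (P' : Set G) := isClosed_of_isOpen_inf_le hPc hP'P hV₀o hV₀
  have hproP : ∀ x ∈ P', ∀ O ∈ nhds (1 : G), ∃ k : ℕ, x ^ p ^ k ∈ O :=
    fun x hx O hO => forall_nhds_pow_mem_of_proP_subgroup P hPc hP (hP'P hx) hO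
  -- `n = p ^ e * n'` with `p ∤ n'`; the `n`-th powers of `P'` are the `p ^ e`-th powers
  obtain ⟨e, n', hn', rfl⟩ := Nat.exists_eq_pow_mul_and_not_dvd hn p hp.out.ne_one
  haveI : CompactSpace P' := isCompact_iff_compactSpace.mp hP'c.isCompact
  have hsurj : Function.Surjective fun x : P' => x ^ n' :=
    pow_surjective_of_proP (isPGroup_quotient_of_forall_nhds_pow_mem P' hproP)
      ((Nat.Prime.coprime_iff_not_dvd hp.out).mpr hn')
  have hset : {y : G | ∃ x ∈ P', x ^ (p ^ e * n') = y} = (fun y : G => y ^ p ^ e) '' (P' : Set G) := by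
    ext y
    constructor
    · rintro ⟨x, hx, rfl⟩
      exact ⟨x ^ n', P'.pow_mem hx n', by dsimp only; rw [← pow_mul, mul_comm]⟩
    · rintro ⟨z, hz, rfl⟩
      obtain ⟨w, hw⟩ := hsurj ⟨z, hz⟩
      refine ⟨(w : G), w.2, ?_⟩
      have hw' : (w : G) ^ n' = z := by
        have := congrArg Subtype.val hw
        simpa only [Subgroup.coe_pow] using this
      rw [mul_comm, pow_mul, hw']
  rw [hset]
  rcases Nat.eq_zero_or_pos e with rfl | he
  · refine ⟨⊤, isOpen_univ, fun x hx => Subgroup.mem_sup_right (Subgroup.subset_closure ?_)⟩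
    exact ⟨x, hx.2, by simp⟩
  -- `e ≥ 1`: closure open (coinvariants) and the subgroup is closed (twisted Serre width)
  obtain ⟨E, hEP', hgenG⟩ := hfng P' hP'n hP'P ⟨V₀, hV₀o, hV₀⟩
  obtain ⟨W, hWo, hW⟩ := exists_isOpen_inf_le_commutator_pow_closure_of_normalGenerators P' hP'c E
    hEP' hgenG U hUo (hP'P.trans hPU) (p ^ e * n') (by positivity)
  rw [hset] at hW
  obtain ⟨l, hlU, hl⟩ := exists_list_closure_dense_of_isOpen hfg U hUo
  obtain ⟨m, hm, hconj⟩ := exists_list_conj_subset_of_isOpen_normal U hUo E hEP'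
  have hgen : (P' : Set G) ⊆ closure ((Subgroup.closure
      {z : G | ∃ u ∈ U, ∃ a ∈ m, z = u * a * u⁻¹} : Subgroup G) : Set G) := by
    intro x hx
    have h := hgenG hx
    rw [← SetLike.mem_coe, Subgroup.topologicalClosure_coe] at h
    exact closure_mono (SetLike.coe_subset_coe.mpr (Subgroup.closure_mono hconj)) h
  have hclosed := isClosed_commutator_sup_powClosure_of_proP U l hlU hl P' hP'c (hP'P.trans hPU)
    m hm hgen hproP (dvd_pow_self p he.ne')
  exact ⟨W, hWo, hW.trans (Subgroup.topologicalClosure_minimal _ le_rfl hclosed)⟩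

/-- **Strong completeness for pro-`p`-by-strongly-complete profinite groups with finitely normally
generated wild layers.** Let `G` be a topologically finitely generated profinite group and `P ⊴ G` a
closed normal pro-`p` subgroup with (a) every finite-index subgroup of `G` containing `P` open and
(fng) every `G`-normal `P′ ≤ P` open in `P` topologically finitely normally generated in `G`.  Then
every finite-index subgroup of `G` is open.  (`isOpen_of_finiteIndex_of_proP_normal` with (c″)
discharged by `forall_exists_isOpen_inf_le_commutator_sup_powClosure`; elementary — Serre-type
successive approximation, no Nikolov–Segal.) [cite: DDMSAnalyticProP1999, Thm 1.17] -/
theorem isOpen_of_finiteIndex_of_proP_of_normalGenerators {p : ℕ} [hp : Fact p.Prime]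
    (hfg : ∃ S : Finset G, Dense ((Subgroup.closure (S : Set G) : Subgroup G) : Set G))
    (P : Subgroup G) [hPn : P.Normal] (hPc : IsClosed (P : Set G))
    (hP : ∀ V : OpenNormalSubgroup P, IsPGroup p (P ⧸ (V : Subgroup P)))
    (ha : ∀ K : Subgroup G, P ≤ K → K.FiniteIndex → IsOpen (K : Set G))
    (hfng : ∀ P' : Subgroup G, P'.Normal → P' ≤ P →
      (∃ V : Subgroup G, IsOpen (V : Set G) ∧ V ⊓ P ≤ P') →
      ∃ E : Finset G, (E : Set G) ⊆ P' ∧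
        P' ≤ (Subgroup.closure {x : G | ∃ g : G, ∃ e ∈ E, x = g * e * g⁻¹}).topologicalClosure)
    (H : Subgroup G) [H.FiniteIndex] : IsOpen (H : Set G) :=
  isOpen_of_finiteIndex_of_proP_normal P hPc hP ha
    (forall_exists_isOpen_inf_le_commutator_sup_powClosure hfg P hPc hP hfng) H

/-- Continuity corollary: under the same hypotheses every homomorphism from `G` to a profinite
(indeed any compact totally disconnected) group... — phrased minimally: every homomorphism to a
FINITE group (discrete topology understood via the kernel) has open kernel.
[cite: DDMSAnalyticProP1999, Thm 1.17] -/
theorem isOpen_ker_of_finite_of_proP_of_normalGenerators {p : ℕ} [hp : Fact p.Prime]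
    (hfg : ∃ S : Finset G, Dense ((Subgroup.closure (S : Set G) : Subgroup G) : Set G))
    (P : Subgroup G) [hPn : P.Normal] (hPc : IsClosed (P : Set G))
    (hP : ∀ V : OpenNormalSubgroup P, IsPGroup p (P ⧸ (V : Subgroup P)))
    (ha : ∀ K : Subgroup G, P ≤ K → K.FiniteIndex → IsOpen (K : Set G))
    (hfng : ∀ P' : Subgroup G, P'.Normal → P' ≤ P →
      (∃ V : Subgroup G, IsOpen (V : Set G) ∧ V ⊓ P ≤ P') →
      ∃ E : Finset G, (E : Set G) ⊆ P' ∧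
        P' ≤ (Subgroup.closure {x : G | ∃ g : G, ∃ e ∈ E, x = g * e * g⁻¹}).topologicalClosure)
    {F : Type*} [Group F] [Finite F] (f : G →* F) : IsOpen (f.ker : Set G) := by
  haveI : Finite (G ⧸ f.ker) := Finite.of_injective _ (QuotientGroup.kerLift_injective f)
  haveI : f.ker.FiniteIndex := Subgroup.finiteIndex_of_finite_quotient
  exact isOpen_of_finiteIndex_of_proP_of_normalGenerators hfg P hPc hP ha hfng f.ker

end Literature.GroupTheory
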